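import Literature.MathematicalPhysics.QuantumFieldTheory.Balaban1983to89.B13Lemma3TorusPrimitive
import Literature.MathematicalPhysics.QuantumFieldTheory.Balaban1983to89.B13Resum220

/-!
# `Balaban1983to89.B13Ineq220Torus` — T. Bałaban, *Renormalization group approach to lattice gauge field theories.
II. Cluster expansions*, Commun. Math. Phys. **116** (1988) 1–22, doi:10.1007/bf01239022 [Balaban1988RG2Cluster]:
**(2.18)–(2.20) p. 16 ON THE TWO-SCALE TORUS FROM LEMMA 2 OF THE RECORD** — the Lemma 2 → Lemma 3 bridge
`Σ_{Y∈𝐃}|τ(Y)||𝐕_k(Y, B)| ≤ ½O(1)α₄Σ_{b⊂Y₀}|B(b)|² + O(1)α₄M⁻⁴|Y₀|` (hypothesis `h220R` of the torus per-term capstone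
`B13Lemma3TorusPrimitive.h226_torus_of_primitives`) PROVED on the periodic carrier from (1.42)/(1.43)/(1.36) of the
record's torus step and R12, both «O(1)» explicit absolute numbers in d = 4

statement-level skeleton of published theorems with citation tags; proofs where landed; nothing here is a claim about
the Yang–Mills mass gap

PDF held: `paper:balaban1988-cmp116-rg-ii-cluster` (journal page = PDF page + 0); p. 16 read this session from the render
`run/shared/lean/pub/pub-balaban/b2b-balaban-ref1/pages/1988-cmp116-rg-II-cluster/1988-cmp116-rg-II-cluster-p016-x2.png`
(the text layer `p0016.txt` drops the displays).

CITATION HEADER (verbatim, render p. 16 [PDF 16]).  *"The expression in the last exponential can be estimated using (1.42),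
and the inequalities (1.43), (1.36). We take a small, positive number α₄, to be chosen later, and
1/|τ(Y)| = E₀ε₁C₁α₄⁻¹M^q exp C₂κ₁ exp(−(1 − 3δ)κd_k(Y)). (2.18) We assume that ⅛(κ₁ − 1) ≧ (1 − 3δ)κ, C₃ ≦ E₀C₁, and
q ≧ 8. The quadratic form in (1.42), after multiplication by |τ(Y)|, can be bounded by
½ Σ_{b,b′⊂Y} α₄M⁻⁴exp(−¼(κ₁ − 1)M⁻⁴|Y| − (1/16)(κ₁ − 1)M⁻¹|b₋ − b′₋|)|B(b)||B(b′)|. (2.19) The sum of these quadratic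
forms over Y∈𝐃 is bounded by a quadratic form with the above matrix elements resummed over all Y∈𝐃_k containing, for
example, the point b₋. We use the first exponential factor in (2.19) to bound the sum, and this yields a constant O(1).
In fact the constant is small for κ₁ large, hence we can bound it by 1. Using (1.28) we obtain
Σ_{Y∈𝐃}|τ(Y)||𝐕_k(Y, B)| ≦ ½ Σ_{b,b′⊂Y₀} α₄M⁻⁴exp(−(1/16)(κ₁ − 1)M⁻¹|b₋ − b′₋|)|B(b)||B(b′)| + Σ_{Y∈𝐃} α₄exp(−δκd_k(Y))
≦ ½O(1)α₄ Σ_{b⊂Y₀}|B(b)|² + O(1)α₄M⁻⁴|Y₀|. (2.20)"*  (The V″-summand `α₄exp(−δκd_k(Y))` is |τ(Y)| × the right side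
of (1.36), `B13Resum220.invTau_mul_vpp220`; «Using (1.28)» = the cube count behind the second O(1), replaced in the tree
by the (1.26)-type sum at rate δκ — cell GAPS G-B13-07 on (1.28) as printed.)

WHAT IS REPRODUCED (cell `pub-ymgap`, HUMAN RULING D-0062 Track A, DAG node N10 = [B13], seat `pub-ymgap-dag-n10-b`;
a NEW LEAF over `B13Lemma3TorusPrimitive` and `B13Resum220`, nothing there modified).  BEFORE THIS FILE: (2.19) from
(1.43) = `B13Bound143.elem219_of_bound143`, |τ|·|V″| from (1.36) = `B13Resum220.vpp_of_bound136`, (2.20) =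
`B13Resum220.ineq220` (abstract cubes) / `ineq220_lattice` (ℤ^d only); the TORUS per-term capstone of (2.26)
`B13Lemma3TorusPrimitive.h226_torus_of_primitives` (→ `hrep_of_termwise` → `bound238_torus` = Lemma 3) takes (2.20) as
the HYPOTHESIS `h220R : ∀ B, Σ_{Y∈𝐃} |τ(Y)|·‖V Y B‖ ≤ a₂₀/2·(B⬝B) + w`, unconnected to Lemma 2 of the record.  HERE:
* §1 **`ineq220_torus`** — `ineq220` ON THE TORUS `TPt 4 n` (`TAdj`, degree ≤ 8 `tdegreeLE`, 𝐃-members torus-face-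
  connected ⇒ `isRConnected_of_tFaceConnected`, (1.26)-sum `sum_exp_torusTreeLen_le` at δκ ≥ 64 log 162), BOTH «O(1)»
  DISCHARGED: the row sum of the (2.20)-kernel over bonds located (≤ m per site) on a site torus `UT Nf` in the ℓ¹ torus
  distance, `≤ m·α₄·M⁻⁴·(1 + 32M/(κ₁−1))^ν` (`rowSum_ker220_torus_le`: `B13Bound226Located.sum_exp_neg_loc_le_pt` +
  `B13Lemma3TorusPrimitive.kc_tdist1`; for ν = 4, M ≥ 1 the ABSOLUTE `m·α₄·(1 + 32/(κ₁−1))⁴`, `rowConst_torus_four_le`)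
  and the V″-constant `K₀(64, 8)`;
* §2 **`norm_quadForm_le_sum_bonds`** — the record's `½⟨Q(Y, B)B, B⟩` at a configuration whose fluctuation field is a real
  field on the bonds `Λ` of Z₀ (zero off `ι(Λ)`), `Q(Y, ·, b, b′) = 0` unless b, b′ ⊂ Y (p. 11), is
  `≤ ½ Σ_{b,b′∈Λ; b,b′⊂Y} |Q(Y, B, ιb, ιb′)|·|B(b)|·|B(b′)|`;
* §3 **`sum_tau_norm_V_le_of_lemma2`** — THE PRINTED (2.20) `Σ_{Y∈𝐃}|τ(Y)||𝐕_k(Y, B)| ≤ …` ON THE TORUS from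
  `B13.Repr142` / `B13.Bound143` / `B13.Bound136 … W.Vpp` of a torus step (three conjuncts of Lemma 2, cf.
  `B13Lemma2Torus.lemma2Printed_twoTorus`), R12, `volk = #Y`, bonds of Z₀ on a site torus (≤ m per site) with G6 in the
  torus distance (`hG6`; ℤ^d PROVED: `B13DiameterG6.G6_l1`), potentials `V Y B = 𝐕_k(Y, B)` agreeing with the record's
  `V_k(Y)` at the configuration `emb B` on (1.34): for every `B` SMALL on 𝐃 (the support of `χ_{k,Y₀}`),
  `Σ_{Y∈𝐃} |τ(Y)|·‖V Y B‖ ≤ ½·(m·α₄·(1 + 32/(κ₁−1))⁴)·(B⬝B) + K₀(64,8)·α₄·#(⋃𝐃)` — both O(1) explicit;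
* §4 **`h220R_of_small`**, **`F214_congr_of_small`** — plumbing to the capstone's letter: the small-field truncation of `V`
  satisfies `h220R` for ALL `B`, and leaves `F214 … V` unchanged when `χ_{Y₀}` vanishes off the small fields (p. 15).
HONEST SCOPE.  (a) By assertion/identification (what a NODE-00 pin supplies): `emb` with `Bv (emb B) = B` along `ι` and
`0` off `ι(Λ)`, the support of `Q(Y, ·, b, b′)` on b, b′ ⊂ Y, `V Y B = W.V Y (emb B)` on (1.34), bond sites (≤ m each),
G6 in the torus distance (LOCATED; ℤ^d proved), `volk = #Y`; numbers: R12, κ₁ ≥ 1 + 4 log 162 (*"for κ₁ large"*),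
δκ ≥ 64 log 162, M ≥ 1, E₀, ε₁, C₁, α₄ > 0, C₃ ≥ 0.  (b) The site torus `UT Nf` is a parameter (as in the capstone).
(c) NOT a discharge of node N10 (B13 group FREE at NODE 00 Stages 1–3); the object-level inputs of the (2.26) capstone
(L16a/L17a, NODE O) are untouched.  One finite T⁴; Bałaban AS PRINTED; nothing continuum ∕ OS ∕ mass-gap ∕ Clay.  No
`sorry`, no definition, no new named fact (D-0026).
-/

noncomputable section

namespace Literature.MathematicalPhysics.QuantumFieldTheory.Balaban1983to89.B13Ineq220Torus

open Finset
open Literature.MathematicalPhysics.QuantumFieldTheory.Balaban1983to89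
open Literature.MathematicalPhysics.QuantumFieldTheory.Balaban1983to89.TreeLengthTorus
open Literature.MathematicalPhysics.QuantumFieldTheory.Balaban1983to89.B12TreeDecay (kappa₀ K₀ a₀)
open Literature.MathematicalPhysics.QuantumFieldTheory.Balaban1983to89.B13Lemma3Torus (TwoTorusStep)
open Literature.MathematicalPhysics.QuantumFieldTheory.Balaban1983to89.B13Bound143 (invTau invTau_pos elem219 R12
  elem219_of_bound143)
open Literature.MathematicalPhysics.QuantumFieldTheory.Balaban1983to89.B13Resum220 (ker220 vpp220 ker220_eq
  ker220_nonneg ineq220 vpp_of_bound136)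
open Literature.MathematicalPhysics.QuantumFieldTheory.Balaban1983to89.B5TorusCover (UT)
open Literature.MathematicalPhysics.QuantumFieldTheory.Balaban1983to89.B9Thm37GlueTorus (tdist1 tdist1_comm)
open Literature.MathematicalPhysics.QuantumFieldTheory.Balaban1983to89.B13Lemma3TorusPrimitive (kc_tdist1)
open Literature.MathematicalPhysics.QuantumFieldTheory.Balaban1983to89.B13Bound226Located (sum_exp_neg_loc_le_pt)
open Literature.MathematicalPhysics.QuantumFieldTheory.Balaban1983to89.B13Term214 (F214)
open Literature.Probability.LatticeModels (IsRConnected)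

/-! ## §1. (2.20) on the torus: the resummation with both «O(1)» discharged -/

section Torus220

variable {n : ℕ} [NeZero n] {ν : ℕ} {Nf : Fin ν → ℕ} [∀ i, NeZero (Nf i)] {β : Type*} [Fintype β]

/-- **The row sum of the (2.20)-kernel on a site torus** (p. 16: *"resummed over all Y∈𝐃_k containing, for example, the
point b₋ … this yields a constant O(1)"*): bonds located at sites of the torus `UT Nf`, at most `m` per site, `κ₁ > 1`,
`M > 0`, `α₄ ≥ 0` ⇒ `Σ_{b′} α₄M⁻⁴e^{−(κ₁−1)/(16M)·d₁(b, b′)} ≤ m·α₄·M⁻⁴·(1 + 2·16M/(κ₁−1))^ν`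
(`B13Lemma3TorusPrimitive.kc_tdist1` grouped by sites, `B13Bound226Located.sum_exp_neg_loc_le_pt`).
[cite: Balaban1988RG2Cluster, (2.20) p.16] -/
theorem rowSum_ker220_torus_le (c : B13.Consts) (hα : 0 ≤ c.α₄) (hκ₁ : 1 < c.κ₁) (hM : 0 < c.M)
    (loc : β → UT Nf) {m : ℕ} (hfib : ∀ x : UT Nf, (univ.filter fun j => loc j = x).card ≤ m) (b : β) :
    ∑ b', ker220 c (tdist1 Nf (loc b) (loc b')) ≤
      m * c.α₄ * (c.M ^ 4)⁻¹ * (1 + 2 / ((c.κ₁ - 1) / (16 * c.M))) ^ ν := by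
  have hrate : 0 < (c.κ₁ - 1) / (16 * c.M) := by
    have : 0 < c.κ₁ - 1 := by linarith
    positivity
  have hsum := sum_exp_neg_loc_le_pt (ρ := tdist1 Nf) (Kc := fun b : ℝ => (1 + 2 / b) ^ ν) kc_tdist1 hrate loc
    hfib (loc b)
  calc ∑ b', ker220 c (tdist1 Nf (loc b) (loc b'))
      = c.α₄ * (c.M ^ 4)⁻¹ * ∑ b', Real.exp (-((c.κ₁ - 1) / (16 * c.M) * tdist1 Nf (loc b) (loc b'))) := by
        rw [mul_sum]
        exact sum_congr rfl fun b' _ => ker220_eq c _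
    _ ≤ c.α₄ * (c.M ^ 4)⁻¹ * (m * (1 + 2 / ((c.κ₁ - 1) / (16 * c.M))) ^ ν) :=
        mul_le_mul_of_nonneg_left hsum (by positivity)
    _ = m * c.α₄ * (c.M ^ 4)⁻¹ * (1 + 2 / ((c.κ₁ - 1) / (16 * c.M))) ^ ν := by ring

/-- **The row constant is ABSOLUTE in dimension four**: for `M ≥ 1`, `κ₁ > 1`,
`M⁻⁴·(1 + 2·16M/(κ₁−1))⁴ ≤ (1 + 32/(κ₁−1))⁴` (the `M⁴` of the site count per cube against the `M⁻⁴` of the matrix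
element — p. 16 *"In fact the constant is small for κ₁ large"*). [cite: Balaban1988RG2Cluster, (2.20) p.16] -/
theorem rowConst_torus_four_le (c : B13.Consts) (hM : 1 ≤ c.M) (hκ₁ : 1 < c.κ₁) :
    (c.M ^ 4)⁻¹ * (1 + 2 / ((c.κ₁ - 1) / (16 * c.M))) ^ 4 ≤ (1 + 32 / (c.κ₁ - 1)) ^ 4 := by
  have hk : 0 < c.κ₁ - 1 := by linarith
  have hM0 : 0 < c.M := by linarith
  have e1 : 1 + 2 / ((c.κ₁ - 1) / (16 * c.M)) = 1 + 32 * c.M / (c.κ₁ - 1) := by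
    field_simp
    ring
  have e2 : (c.M ^ 4)⁻¹ * (1 + 32 * c.M / (c.κ₁ - 1)) ^ 4 = (c.M⁻¹ * (1 + 32 * c.M / (c.κ₁ - 1))) ^ 4 := by
    rw [mul_pow, inv_pow]
  have e3 : c.M⁻¹ * (1 + 32 * c.M / (c.κ₁ - 1)) = c.M⁻¹ + 32 / (c.κ₁ - 1) := by
    field_simp
  rw [e1, e2, e3]
  have hinv : c.M⁻¹ ≤ 1 := inv_le_one_of_one_le₀ hM
  have h0 : 0 ≤ c.M⁻¹ + 32 / (c.κ₁ - 1) := by positivity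
  exact pow_le_pow_left₀ h0 (by linarith) 4

/-- **(2.20) ON THE TORUS**, both «O(1)» discharged (p. 16): cubes `TPt 4 n` with common-wall adjacency, `D` a finite
family of localization domains (non-empty, torus-face-connected), bonds `β` located on a site torus `UT Nf` (≤ m per
site) with `cube b ∈ Y` for `b ∈ sY Y`, `θ_b ≥ 0`, inputs in the shape (2.19) delivers them (`q ≤ elem219(#Y, d₁)`,
`v ≤ α₄e^{−δκd_k}`); under `¼(κ₁−1) ≥ log 162`, `δκ ≥ 64 log 162`, `M > 0`, `α₄ ≥ 0`:
`Σ_{Y∈D} (½Σ_{b,b′⊂Y} q θ_bθ_{b′} + v(Y)) ≤ ½·(m·α₄·M⁻⁴(1 + 32M/(κ₁−1))^ν)·Σ_b θ_b² + K₀(64, 8)·α₄·#(⋃D)` —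
`B13Resum220.ineq220` with `TAdj`, `TreeLengthTorus.sum_exp_torusTreeLen_le`, `rowSum_ker220_torus_le`.
[cite: Balaban1988RG2Cluster, (2.20) p.16] -/
theorem ineq220_torus (c : B13.Consts) (hα : 0 ≤ c.α₄) (hM : 0 < c.M) (hκ₁' : 1 < c.κ₁)
    (hκ₁ : Real.log 162 ≤ 1 / 4 * (c.κ₁ - 1)) (hδκ : 64 * Real.log 162 ≤ c.δ * c.κ)
    (D : Finset (Finset (TPt 4 n))) (hD : ∀ Y ∈ D, Y.Nonempty ∧ TFaceConnected Y)
    (sY : Finset (TPt 4 n) → Finset β) (cube : β → TPt 4 n) (hcube : ∀ Y ∈ D, ∀ b ∈ sY Y, cube b ∈ Y)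
    (loc : β → UT Nf) {m : ℕ} (hfib : ∀ x : UT Nf, (univ.filter fun j => loc j = x).card ≤ m)
    (θ : β → ℝ) (hθ : ∀ b, 0 ≤ θ b) (q : Finset (TPt 4 n) → β → β → ℝ)
    (hq : ∀ Y ∈ D, ∀ b ∈ sY Y, ∀ b' ∈ sY Y, q Y b b' ≤ elem219 c Y.card (tdist1 Nf (loc b) (loc b')))
    (v : Finset (TPt 4 n) → ℝ) (hv : ∀ Y ∈ D, v Y ≤ vpp220 c (torusTreeLen Y)) :
    ∑ Y ∈ D, (1 / 2 * ∑ b ∈ sY Y, ∑ b' ∈ sY Y, q Y b b' * (θ b * θ b') + v Y)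
      ≤ 1 / 2 * (m * c.α₄ * (c.M ^ 4)⁻¹ * (1 + 2 / ((c.κ₁ - 1) / (16 * c.M))) ^ ν) * ∑ b, θ b ^ 2
        + K₀ 64 8 * c.α₄ * (D.biUnion id).card := by
  classical
  have ha₀ : a₀ (2 * 4) ≤ 1 / 4 * (c.κ₁ - 1) := by
    rwa [show a₀ (2 * 4) = Real.log 162 by norm_num [a₀]]
  have hk : kappa₀ (4 * 2 ^ 4) (2 * 4) ≤ c.δ * c.κ := by rwa [TreeLengthCubeSystem.kappa₀_four]
  have hK : K₀ (4 * 2 ^ 4) (2 * 4) = K₀ 64 8 := by norm_num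
  rw [← hK]
  refine ineq220 (R := TAdj) (nbr := tnbr) (Δ := 2 * 4) (β := β) (fun x y h => h.symm) (tdegreeLE 4 n)
    (fun x y h => mem_tnbr.2 h) c hα ha₀ D (fun Y hY => isRConnected_of_tFaceConnected (hD Y hY).1 (hD Y hY).2)
    univ sY (fun Y _ => subset_univ _) cube hcube (fun b b' => tdist1 Nf (loc b) (loc b'))
    (fun b _ b' _ => tdist1_comm _ _) (fun b _ => rowSum_ker220_torus_le c hα hκ₁' hM loc hfib b) θ
    (fun b _ => hθ b) q hq torusTreeLen v hv fun x _ => ?_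
  -- (1.26) on the torus, for the members of D through the cube x
  simp_rw [show ∀ Y : Finset (TPt 4 n), -(c.δ * c.κ * torusTreeLen Y) = -(c.δ * c.κ) * torusTreeLen Y from
    fun Y => by rw [neg_mul]]
  calc ∑ Y ∈ D with x ∈ Y, Real.exp (-(c.δ * c.κ) * torusTreeLen Y)
      ≤ ∑ X ∈ (univ : Finset (Finset (TPt 4 n))).filter (fun X => x ∈ X ∧ TFaceConnected X),
          Real.exp (-(c.δ * c.κ) * torusTreeLen X) :=
        sum_le_sum_of_subset_of_nonneg (fun Y hY => mem_filter.2
          ⟨mem_univ _, (mem_filter.1 hY).2, (hD Y (mem_filter.1 hY).1).2⟩) fun X _ _ => (Real.exp_pos _).le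
    _ ≤ K₀ (4 * 2 ^ 4) (2 * 4) := sum_exp_torusTreeLen_le 4 n x hk

end Torus220

/-! ## §2. The record's quadratic form at a real fluctuation field on the bonds of Z₀ -/

section QuadForm

variable {Λ : Type*} [Fintype Λ]

/-- **The quadratic form of (1.42) read on the bonds of Z₀**: for step data `S`, a configuration `φ` whose fluctuation
field is the real field `B : Λ → ℝ` extended by zero along an injection `ι : Λ → S.Bond`, and matrix elements supported on
the bonds of Y (`S.Q Y φ b b′ = 0` unless `inY b ∧ inY b′` — p. 11, `V_k(Y)` localized in Y):
`‖½⟨Q(Y, B)B, B⟩‖ ≤ ½ Σ_{b,b′∈Λ, inY (ι b), inY (ι b′)} ‖Q(Y, B, ι b, ι b′)‖·|B(b)|·|B(b′)|`.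
[cite: Balaban1988RG2Cluster, (1.42) p.11, (2.19) p.16] -/
theorem norm_quadForm_le_sum_bonds (S : B13.StepData) (Y : S.Dk.Dom) (φ : S.Φ) (ι : Λ → S.Bond)
    (hι : Function.Injective ι) (B : Λ → ℝ) (hBv : ∀ b, S.Bv φ (ι b) = (B b : ℂ))
    (hBv0 : ∀ b', b' ∉ Set.range ι → S.Bv φ b' = 0) (inY : S.Bond → Prop) [DecidablePred inY]
    (hQ : ∀ b b', S.Q Y φ b b' ≠ 0 → inY b ∧ inY b') :
    ‖S.quadForm Y φ‖ ≤ 1 / 2 * ∑ b ∈ univ.filter (fun b => inY (ι b)), ∑ b' ∈ univ.filter (fun b => inY (ι b)),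
      ‖S.Q Y φ (ι b) (ι b')‖ * (|B b| * |B b'|) := by
  classical
  letI := S.finBond
  -- the norm of the double sum
  have h1 : ‖S.quadForm Y φ‖ ≤ 1 / 2 * ∑ b, ∑ b', ‖S.Q Y φ b b'‖ * (‖S.Bv φ b‖ * ‖S.Bv φ b'‖) := by
    unfold B13.StepData.quadForm
    rw [norm_mul, show ‖(1 / 2 : ℂ)‖ = 1 / 2 by norm_num]
    refine mul_le_mul_of_nonneg_left ((norm_sum_le _ _).trans (sum_le_sum fun b _ =>
      (norm_sum_le _ _).trans (sum_le_sum fun b' _ => ?_))) (by norm_num)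
    rw [norm_mul, norm_mul, mul_assoc]
  -- the summand vanishes off `ι(Λ) × ι(Λ)` and off the bonds of Y
  set g : S.Bond → S.Bond → ℝ := fun b b' => ‖S.Q Y φ b b'‖ * (‖S.Bv φ b‖ * ‖S.Bv φ b'‖) with hg
  have hg0 : ∀ b b', 0 ≤ g b b' := fun b b' => by positivity
  have hgoff : ∀ b b', (b ∉ Set.range ι ∨ b' ∉ Set.range ι) → g b b' = 0 := by
    rintro b b' (hb | hb')
    · simp [hg, hBv0 b hb]
    · simp [hg, hBv0 b' hb']
  -- reindex the outer and inner sums along ι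
  have hre : ∀ f : S.Bond → ℝ, (∀ b, b ∉ Set.range ι → f b = 0) → ∑ b, f b = ∑ a, f (ι a) := by
    intro f hf
    rw [← sum_image (f := f) (s := univ) (g := ι) (fun a _ a' _ h => hι h)]
    symm
    refine sum_subset (subset_univ _) fun b _ hb => hf b ?_
    intro ⟨a, ha⟩
    exact hb (mem_image.2 ⟨a, mem_univ _, ha⟩)
  have h2 : ∑ b, ∑ b', g b b' = ∑ a, ∑ a', g (ι a) (ι a') := by
    rw [hre (fun b => ∑ b', g b b') (fun b hb => sum_eq_zero fun b' _ => hgoff b b' (Or.inl hb))]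
    exact sum_congr rfl fun a _ => hre _ fun b' hb' => hgoff _ _ (Or.inr hb')
  -- restrict to the bonds of Y
  have hgY : ∀ a a', ¬ (inY (ι a) ∧ inY (ι a')) → g (ι a) (ι a') = 0 := by
    intro a a' hne
    have hz : S.Q Y φ (ι a) (ι a') = 0 := by
      by_contra hz
      exact hne (hQ _ _ hz)
    simp [hg, hz]
  have h3 : ∑ a, ∑ a', g (ι a) (ι a') =
      ∑ a ∈ univ.filter (fun b => inY (ι b)), ∑ a' ∈ univ.filter (fun b => inY (ι b)), g (ι a) (ι a') := by
    symm
    rw [sum_filter]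
    refine sum_congr rfl fun a _ => ?_
    split_ifs with ha
    · rw [sum_filter]
      refine sum_congr rfl fun a' _ => ?_
      split_ifs with ha'
      · rfl
      · exact (hgY a a' fun h => ha' h.2).symm
    · exact (sum_eq_zero fun a' _ => hgY a a' fun h => ha h.1).symm
  have h4 : ∀ a a', g (ι a) (ι a') = ‖S.Q Y φ (ι a) (ι a')‖ * (|B a| * |B a'|) := fun a a' => by
    simp only [hg, hBv, Complex.norm_real, Real.norm_eq_abs]
  calc ‖S.quadForm Y φ‖ ≤ 1 / 2 * ∑ b, ∑ b', g b b' := h1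
    _ = 1 / 2 * ∑ a ∈ univ.filter (fun b => inY (ι b)), ∑ a' ∈ univ.filter (fun b => inY (ι b)),
          g (ι a) (ι a') := by rw [h2, h3]
    _ = _ := by simp only [h4]

end QuadForm

/-! ## §3. The bridge: (2.18)–(2.20) on the two-scale torus from Lemma 2 of the record -/

section Bridge

variable {L N' : ℕ} [NeZero L] [NeZero N'] {Nf : Fin 4 → ℕ} [∀ i, NeZero (Nf i)]
variable {Λ : Type*} [Fintype Λ]

/-- **(2.18)–(2.20) ON THE TWO-SCALE TORUS FROM LEMMA 2** (p. 16, verbatim in the module header).  Carrier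
`W : TwoTorusStep 4 L N′` with (1.42) `B13.Repr142`, (1.43) `B13.Bound143`, (1.36) for V″ `B13.Bound136 … W.Vpp`,
`volk = #Y`, R12, κ₁ ≥ 1 + 4 log 162, δκ ≥ 64 log 162, M ≥ 1, E₀, ε₁, C₁, α₄ > 0, C₃ ≥ 0.  THE TERM: its family 𝐃, the
bonds `Λ` of Z₀ injected by `ι` into the record's bonds, the cube map with `Q(Y, ·, b, b′) = 0` unless
`cube b, cube b′ ∈ Y` (p. 11), sites on a torus `UT Nf` (ν = 4, ≤ m bonds per site), G6 in the torus distance (`hG6`;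
ℤ^d: `B13DiameterG6.G6_l1`), the embedding `emb` of the real field `B : Λ → ℝ` (`Bv (emb B) (ι b) = B b`, `0` off
`ι(Λ)`) and potentials `V Y B = 𝐕_k(Y, B)` agreeing with the record's `V_k(Y)` at `emb B` on (1.34).  CONCLUSION, for
every `B` with `emb B ∈ sp1 Y` for all `Y ∈ 𝐃`:
`Σ_{Y∈𝐃} |τ(Y)|·‖V Y B‖ ≤ ½·(m·α₄·(1 + 32/(κ₁−1))⁴)·(B⬝B) + K₀(64, 8)·α₄·#(⋃𝐃)` — the letter of `h220R` with
`a₂₀ = m·α₄·(1 + 32/(κ₁−1))⁴`, `w = K₀(64, 8)·α₄·#(⋃𝐃)`. [cite: Balaban1988RG2Cluster, (2.18)–(2.20) p.16] -/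
theorem sum_tau_norm_V_le_of_lemma2 (W : TwoTorusStep 4 L N') (c : B13.Consts)
    (hrepr : B13.Repr142 W.toStepData) (h143 : B13.Bound143 W.toStepData c)
    (h136 : B13.Bound136 W.toStepData c W.Vpp) (hvolk : ∀ Y, W.volk Y = Y.1.card)
    (h12 : R12 c) (hC₃ : 0 ≤ c.C₃) (hE : 0 < c.E₀) (hε : 0 < c.ε₁) (hC₁ : 0 < c.C₁) (hα : 0 < c.α₄)
    (hM : 1 ≤ c.M) (hκ₁ : 1 + 4 * Real.log 162 ≤ c.κ₁) (hδκ : 64 * Real.log 162 ≤ c.δ * c.κ)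
    -- the term: its family 𝐃, the bonds of Z₀, their cubes and sites
    (Dfam : Finset (TDom 4 (L * N'))) (ι : Λ → W.Bond) (hι : Function.Injective ι)
    (cube : W.Bond → TPt 4 (L * N'))
    (hQsupp : ∀ (Y : TDom 4 (L * N')) φ b b', W.Q Y φ b b' ≠ 0 → cube b ∈ Y.1 ∧ cube b' ∈ Y.1)
    (loc : Λ → UT Nf) {m : ℕ} (hfib : ∀ x : UT Nf, (univ.filter fun j => loc j = x).card ≤ m)
    (hG6 : ∀ Y ∈ Dfam, ∀ b b' : Λ, cube (ι b) ∈ Y.1 → cube (ι b') ∈ Y.1 →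
      tdist1 Nf (loc b) (loc b') ≤ 4 * c.M * (Y.1.card : ℝ))
    -- the real fluctuation field inside the record's configurations, the potentials of (2.14)
    (emb : (Λ → ℝ) → W.Φ) (hBv : ∀ B b, W.Bv (emb B) (ι b) = (B b : ℂ))
    (hBv0 : ∀ B b', b' ∉ Set.range ι → W.Bv (emb B) b' = 0)
    (V : TDom 4 (L * N') → (Λ → ℝ) → ℂ)
    (hV : ∀ Y ∈ Dfam, ∀ B, emb B ∈ W.sp1 Y → V Y B = W.V Y (emb B))
    (B : Λ → ℝ) (hsmall : ∀ Y ∈ Dfam, emb B ∈ W.sp1 Y) :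
    ∑ Y ∈ Dfam, (invTau c ((tsys 4 (L * N')).dj Y))⁻¹ * ‖V Y B‖ ≤
      (m * c.α₄ * (1 + 32 / (c.κ₁ - 1)) ^ 4) / 2 * (B ⬝ᵥ B) +
        K₀ 64 8 * c.α₄ * (((Dfam.image Subtype.val).biUnion id).card : ℝ) := by
  classical
  have hκ₁' : 1 < c.κ₁ := by linarith [Real.log_pos (show (1 : ℝ) < 162 by norm_num)]
  have hM0 : 0 < c.M := by linarith
  set φ : W.Φ := emb B with hφdef
  -- per Y: (1.42) then (2.19) for the quadratic part and α₄e^{−δκd_k} for V″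
  set sY : Finset (TPt 4 (L * N')) → Finset Λ := fun X => univ.filter fun b => cube (ι b) ∈ X with hsY
  set q : Finset (TPt 4 (L * N')) → Λ → Λ → ℝ := fun X b b' =>
    if hX : IsTDom X then (invTau c (torusTreeLen X))⁻¹ * ‖W.Q ⟨X, hX⟩ φ (ι b) (ι b')‖ else 0 with hq
  set v : Finset (TPt 4 (L * N')) → ℝ := fun X =>
    if hX : IsTDom X then (invTau c (torusTreeLen X))⁻¹ * ‖W.Vpp ⟨X, hX⟩ φ‖ else 0 with hv
  have hτ0 : ∀ Y : TDom 4 (L * N'), 0 ≤ (invTau c ((tsys 4 (L * N')).dj Y))⁻¹ :=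
    fun Y => (inv_pos.2 (invTau_pos c hE hε hC₁ hα hM0 _)).le
  have hperY : ∀ Y ∈ Dfam, (invTau c ((tsys 4 (L * N')).dj Y))⁻¹ * ‖V Y B‖ ≤
      1 / 2 * ∑ b ∈ sY Y.1, ∑ b' ∈ sY Y.1, q Y.1 b b' * (|B b| * |B b'|) + v Y.1 := by
    intro Y hY
    have hφ : φ ∈ W.sp1 Y := hsmall Y hY
    have hrep : W.V Y φ = W.toStepData.quadForm Y φ + W.Vpp Y φ := hrepr Y φ hφ
    rw [hV Y hY B hφ, ← hφdef, hrep]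
    have hqf := norm_quadForm_le_sum_bonds W.toStepData Y φ ι hι B (hBv B) (hBv0 B)
      (fun b => cube b ∈ Y.1) (fun b b' h => hQsupp Y φ b b' h)
    have hY2 : IsTDom Y.1 := Y.2
    have hqY : ∀ b b', q Y.1 b b' = (invTau c (torusTreeLen Y.1))⁻¹ * ‖W.Q Y φ (ι b) (ι b')‖ := fun b b' => by
      simp only [hq, dif_pos hY2, Subtype.coe_eta]
    have hvY : v Y.1 = (invTau c (torusTreeLen Y.1))⁻¹ * ‖W.Vpp Y φ‖ := by
      simp only [hv, dif_pos hY2, Subtype.coe_eta]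
    calc (invTau c ((tsys 4 (L * N')).dj Y))⁻¹ * ‖W.toStepData.quadForm Y φ + W.Vpp Y φ‖
        ≤ (invTau c ((tsys 4 (L * N')).dj Y))⁻¹ * (‖W.toStepData.quadForm Y φ‖ + ‖W.Vpp Y φ‖) :=
          mul_le_mul_of_nonneg_left (norm_add_le _ _) (hτ0 Y)
      _ ≤ (invTau c ((tsys 4 (L * N')).dj Y))⁻¹ *
            (1 / 2 * ∑ b ∈ sY Y.1, ∑ b' ∈ sY Y.1, ‖W.Q Y φ (ι b) (ι b')‖ * (|B b| * |B b'|) + ‖W.Vpp Y φ‖) :=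
          mul_le_mul_of_nonneg_left (add_le_add hqf le_rfl) (hτ0 Y)
      _ = 1 / 2 * ∑ b ∈ sY Y.1, ∑ b' ∈ sY Y.1, q Y.1 b b' * (|B b| * |B b'|) + v Y.1 := by
          simp only [hqY, hvY, tsys_dj, mul_add, mul_sum]
          congr 1
          refine sum_congr rfl fun b _ => sum_congr rfl fun b' _ => ?_
          ring
  -- sum over 𝐃 and resum on the torus
  have hD : ∀ X ∈ Dfam.image Subtype.val, X.Nonempty ∧ TFaceConnected X := fun X hX => by
    obtain ⟨Y, -, rfl⟩ := mem_image.1 hX; exact Y.2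
  have hqle : ∀ X ∈ Dfam.image Subtype.val, ∀ b ∈ sY X, ∀ b' ∈ sY X,
      q X b b' ≤ elem219 c X.card (tdist1 Nf (loc b) (loc b')) := by
    intro X hX b hb b' hb'
    obtain ⟨Y, hY, rfl⟩ := mem_image.1 hX
    have hb1 : cube (ι b) ∈ Y.1 := (mem_filter.1 hb).2
    have hb2 : cube (ι b') ∈ Y.1 := (mem_filter.1 hb').2
    simp only [hq, dif_pos Y.2, Subtype.coe_eta]
    have hvolk' : ((W.toStepData.volk Y : ℕ) : ℝ) = (Y.1.card : ℝ) := by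
      show ((W.volk Y : ℕ) : ℝ) = _; rw [hvolk Y]
    have hG6' : tdist1 Nf (loc b) (loc b') ≤ 4 * c.M * ((W.toStepData.volk Y : ℕ) : ℝ) := by
      rw [hvolk']; exact hG6 Y hY b b' hb1 hb2
    have h := elem219_of_bound143 W.toStepData c h143 h12 hC₃ hE hε hC₁ hα hM hκ₁'.le Y φ (ι b) (ι b')
      (hsmall Y hY) hG6'
    rwa [hvolk'] at h
  have hvle : ∀ X ∈ Dfam.image Subtype.val, v X ≤ vpp220 c (torusTreeLen X) := fun X hX => by
    obtain ⟨Y, hY, rfl⟩ := mem_image.1 hX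
    simp only [hv, dif_pos Y.2]
    exact vpp_of_bound136 W.toStepData c h136 hE hε hC₁ hα hM0 Y φ (hsmall Y hY)
  have h220 := ineq220_torus (Nf := Nf) c hα.le hM0 hκ₁' (by linarith) hδκ (Dfam.image Subtype.val) hD sY
    (fun b => cube (ι b)) (fun X _ b hb => (mem_filter.1 hb).2) loc hfib (fun b => |B b|) (fun b => abs_nonneg _)
    q hqle v hvle
  have hsumD : ∑ Y ∈ Dfam, (invTau c ((tsys 4 (L * N')).dj Y))⁻¹ * ‖V Y B‖ ≤
      ∑ X ∈ Dfam.image Subtype.val, (1 / 2 * ∑ b ∈ sY X, ∑ b' ∈ sY X, q X b b' * (|B b| * |B b'|) + v X) := by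
    rw [sum_image fun Y _ Y' _ h => Subtype.ext h]
    exact sum_le_sum hperY
  have hθ2 : ∑ b, |B b| ^ 2 = B ⬝ᵥ B := by simp only [dotProduct, pow_two, abs_mul_abs_self]
  have hBB : 0 ≤ B ⬝ᵥ B := by rw [← hθ2]; exact sum_nonneg fun b _ => sq_nonneg _
  refine hsumD.trans (h220.trans ?_)
  rw [hθ2]
  have hcoef : 1 / 2 * (m * c.α₄ * (c.M ^ 4)⁻¹ * (1 + 2 / ((c.κ₁ - 1) / (16 * c.M))) ^ 4) ≤
      (m * c.α₄ * (1 + 32 / (c.κ₁ - 1)) ^ 4) / 2 := by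
    have h := mul_le_mul_of_nonneg_left (rowConst_torus_four_le c hM hκ₁') (show 0 ≤ (m : ℝ) * c.α₄ by positivity)
    calc 1 / 2 * (m * c.α₄ * (c.M ^ 4)⁻¹ * (1 + 2 / ((c.κ₁ - 1) / (16 * c.M))) ^ 4)
        = 1 / 2 * ((m * c.α₄) * ((c.M ^ 4)⁻¹ * (1 + 2 / ((c.κ₁ - 1) / (16 * c.M))) ^ 4)) := by ring
      _ ≤ 1 / 2 * ((m * c.α₄) * (1 + 32 / (c.κ₁ - 1)) ^ 4) := by linarith
      _ = (m * c.α₄ * (1 + 32 / (c.κ₁ - 1)) ^ 4) / 2 := by ring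
  exact add_le_add (mul_le_mul_of_nonneg_right hcoef hBB) le_rfl

end Bridge

/-! ## §4. Plumbing to the capstone's letter: the small-field truncation -/

section Truncation

variable {D : Type*} {Λ : Type} (Dfam : Finset D)

/-- **`h220R` for all fields from the small-field bound**: if `Σ_{Y∈𝐃} R_Y·‖V Y B‖ ≤ a/2·(B⬝B) + w` holds for the
SMALL fields (`Small B`; in (2.14): `χ_{k,Y₀}(B) ≠ 0`) and `a, w ≥ 0`, the truncated family `if Small B then V Y B else 0`
satisfies it for ALL `B` — the letter `h220R` of `B13Lemma3TorusPrimitive.h226_torus_of_primitives`.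
[cite: Balaban1988RG2Cluster, (2.20) p.16] -/
theorem h220R_of_small [Fintype Λ] (R : D → ℝ) (V : D → (Λ → ℝ) → ℂ) (Small : (Λ → ℝ) → Prop)
    [DecidablePred Small] {a w : ℝ} (ha : 0 ≤ a) (hw : 0 ≤ w)
    (h : ∀ B, Small B → ∑ Y ∈ Dfam, R Y * ‖V Y B‖ ≤ a / 2 * (B ⬝ᵥ B) + w) (B : Λ → ℝ) :
    ∑ Y ∈ Dfam, R Y * ‖(fun Y B => if Small B then V Y B else 0) Y B‖ ≤ a / 2 * (B ⬝ᵥ B) + w := by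
  by_cases hB : Small B
  · simpa [hB] using h B hB
  · have hBB : 0 ≤ B ⬝ᵥ B := by
      simp only [dotProduct]
      exact sum_nonneg fun b _ => mul_self_nonneg _
    simp only [hB, if_false, norm_zero, mul_zero, sum_const_zero]
    positivity

/-- **The truncation is invisible under the characteristic function**: if `χ_{Y₀}(B) = 0` off the small fields, the last
line of (2.14) `F214 |P| χ_{Y₀} χᶜ_P 𝐃 V` is unchanged by the small-field truncation of `V`. [cite: Balaban1988RG2Cluster, (2.14) p.15] -/
theorem F214_congr_of_small (cardP : ℕ) (χY₀ χcP : (Λ → ℝ) → ℝ) (V : D → (Λ → ℝ) → ℂ)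
    (Small : (Λ → ℝ) → Prop) [DecidablePred Small] (hχ : ∀ B, ¬ Small B → χY₀ B = 0) :
    F214 cardP χY₀ χcP Dfam (fun Y B => if Small B then V Y B else 0) = F214 cardP χY₀ χcP Dfam V := by
  funext τ B
  by_cases hB : Small B
  · simp [F214, hB]
  · simp [F214, hχ B hB]

end Truncation

end Literature.MathematicalPhysics.QuantumFieldTheory.Balaban1983to89.B13Ineq220Torus

end
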